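import Summits.BirchSwinnertonDyer.BirchSwinnertonDyer.Theorems.GoldfeldAllTwistsTwoConverseTwinOddTwoPrimesTwistSelmerPlusPOneAlpha
import Summits.BirchSwinnertonDyer.BirchSwinnertonDyer.Theorems.GoldfeldAllTwistsTwoConverseTwinOddTwoPrimesTwistSelmerDualPlusPOneAlpha
import Summits.BirchSwinnertonDyer.BirchSwinnertonDyer.Theorems.GoldfeldAllTwistsTwoConverseTwinOddTwoPrimesTwistDescent
import HarnessLib

set_option linter.dupNamespace false -- namespace `…BirchSwinnertonDyer.BirchSwinnertonDyer…` is the cell's (D-0017 nested layout)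
set_option autoImplicit false

/-!
# OBJECT A7⁺, tranche T1, file D3⁺: `corank_{ℤ₂} Sel_{2^∞}(49a1^{(−qp)}) = 1` and **`r_an(49a1^{(−qp)}) = 1`** on a71+ (`q ≡ 7 (8)`, `(q/7) = −1`;
# `p ≡ 1 (8)`, `(−7/p) = 1`, type α; `(p/q) = +1`) — the χ_Z channel's input `h2` DISCHARGED by first descent, `2`-parity and BCST Thm. A (D3's twin)

Cell `bsd-goldfeld`, seat `bsd-goldfeld-s1p-c3x` (gen 15); planner RULING (ccclxxxii) ORDER «OBJECT A7⁺ BY THE χ_Z CHANNEL», tranche T1, file D3⁺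
(memo `HOME/PLUS-CHIZ-CHANNEL.md` §0 row 6, §2). `--supports stmt-BirchSwinnertonDyer-20044` as a HELPER (rank axis: on the α⁺ cells the live lift is σ̃_q and
`χ_Z(σ̃_q) = [h2]`). Theses-free; theorems only; no definition, no new fact, no `sorry`. BINDERS BY NAME: Modularity `hnf`, CLTZ Thm. 1.2 `h12`, `2`-parity `hpar`,
and for the analytic rank BCST Thm. A `hBCST` (item 20045's constant; admissible on the odd-twist branch per RULING (cccxxxi)/(ccclx)/(ccclxxxii)). FRONTIER-grade:
a twist-density-ZERO sub-family modulo named print; never distance-to-summit.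

THE ARGUMENT = D3 (`…TwinOddTwoPrimesTwistDescentPOne`, p670286) VERBATIM with the a71+ Selmer counts D⁺-3 / D⁺-4 (`#S ≤ 2`, `#S′ ≤ 4`; seat's kill
tables and kit j322778: `(S, S′) = ({1,7}, {1,−7,−q,7q})`, ellrank `[1,1,0]` on 20/20 a71+ rows, `r_an = 1` where computed):
* `selmerCorank_two_eq_one_oddTwoPrimesTwist_plusPOneAlpha`: `corank_{ℤ₂} Sel_{2^∞}(W) = 1` for every model `W` of `49a1^{(−qp)}`;
* **`analyticRank_eq_one_oddTwoPrimesTwist_of_thmA_plusPOneAlpha`**: `r_an(X₀(49)^{(−qp)}) = 1` (BCST Thm. A on the good-at-`2` minimal model `G_k`,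
  `−qp = 4k+1`; isogeny-invariance of `r_an`).
HONEST FRAMING: nothing here proves BSD; items 19140 / 20044 / 20045 unchanged; BSD is not proved by any of this.

References: [DokchitserDokchitserAnnals2010] Thm. 1.4; [BurungaleCastellaSkinnerTian2022] Thm. A, Rem. D; [SilvermanAEC2009] X.4.2, X.4.9, VII.5.1.
-/

noncomputable section

open scoped Classical

open WeierstrassCurve Literature.NumberTheory.EllipticCurves Literature.NumberTheory.EllipticCurves.ModularForms

namespace Summit.BirchSwinnertonDyer.BirchSwinnertonDyer.Theorems.GoldfeldGoodTwists

section OddDescentPlusPOneAlpha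
variable {q p : ℕ} [Fact q.Prime] [Fact p.Prime]

/-- **`corank_{ℤ₂} Sel_{2^∞}(W) = 1` for every model `W` of `49a1^{(−qp)}` on a71+** (`q ≡ 7 (8)` prime, `(q/7) = −1`; `p ≡ 1 (8)` prime, `(−7/p) = 1`,
type α; `(p/q) = +1`), granted Modularity, CLTZ Thm. 1.2 at `R = 1` and `2`-parity: `#S·#S′ ≤ 2·4 = 8` (D⁺-3 / D⁺-4) in the cell's generic frame.
[cite: DokchitserDokchitserAnnals2010, Thm. 1.4] [cite: SilvermanAEC2009, Thm. X.4.2(a), Prop. X.4.9] -/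
theorem selmerCorank_two_eq_one_oddTwoPrimesTwist_plusPOneAlpha (hnf : exists_isNewformOf) (h12 : CoatesLiTianZhai2015.thm12_fullBSD_twist)
    (hpar : ∀ (V : WeierstrassCurve ℚ) [V.IsElliptic], p_parity V 2)
    (hq8 : q % 8 = 7) (hq7 : jacobiSym q 7 = -1) (hp8 : p % 8 = 1) (hp7 : legendreSym p (-7) = 1) (hα : ¬ ∃ x : ZMod p, x ^ 4 = -7)
    (hpq : jacobiSym p q = 1)
    (W : WeierstrassCurve ℚ) [W.IsElliptic] (C : VariableChange ℚ) (hC : C • W = cm7.quadraticTwist ((-((q : ℤ) * p) : ℤ) : ℚ)) :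
    W.selmerCorank 2 = 1 := by
  have hq : q.Prime := Fact.out
  have hp : p.Prime := Fact.out
  obtain ⟨⟨hq2, hp2, hqp, -, h7Q, h7P⟩, -⟩ := oddTwoPrimes_facts_plusPOne hq8 hq7 hp8 hp7 hpq
  have hsq : Squarefree (-((q : ℤ) * p)) := by
    have h := (Int.squarefree_natCast.mpr ((Nat.squarefree_mul ((Nat.coprime_primes hq hp).mpr hqp)).mpr
      ⟨hq.squarefree, hp.squarefree⟩))
    exact h.squarefree_of_dvd ⟨-1, by push_cast; ring⟩
  have h7 : ¬ (7 : ℤ) ∣ -((q : ℤ) * p) := by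
    rw [Int.dvd_neg]; exact not_seven_dvd_mul_oddTwoPrimes h7Q h7P
  have hd : -((q : ℤ) * p) < 0 := by
    have : (0 : ℤ) < q := by exact_mod_cast hq.pos
    have : (0 : ℤ) < p := by exact_mod_cast hp.pos
    nlinarith
  have hE := (smul_eq_twoTorsionModel_of_smul_eq_quadraticTwist (-((q : ℤ) * p)) W C hC).trans
    (show (⟨0, ((21 * (-((q : ℤ) * p)) : ℤ) : ℚ), 0, ((112 * (-((q : ℤ) * p)) ^ 2 : ℤ) : ℚ), 0⟩ : WeierstrassCurve ℚ) =
        ⟨0, ((-21 * ((q : ℤ) * p) : ℤ) : ℚ), 0, ((112 * ((q : ℤ) * p) ^ 2 : ℤ) : ℚ), 0⟩ by ext <;> push_cast <;> ring)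
  have hab := hab_inertTwist (m := q * p) (Nat.mul_pos hq.pos hp.pos)
  push_cast at hab
  have hS := card_twoIsogenySelmerGroup_oddTwoPrimesTwist_le_two_plusPOneAlpha hq8 hq7 hp8 hp7 hα hpq
  have hS' := card_twoIsogenySelmerGroup'_oddTwoPrimesTwist_le_four_plusPOneAlpha hq8 hq7 hp8 hp7 hα hpq
  exact selmerCorank_two_eq_one_of_smul_eq_of_card_mul_le hnf h12 hpar hsq h7 hd W C hC hab _ hE
    (by nlinarith [hS, hS', Nat.zero_le (twoIsogenySelmerGroup (-21 * ((q : ℤ) * p)) (112 * ((q : ℤ) * p) ^ 2)).card])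

/-- **`r_an(X₀(49)^{(−qp)}) = 1` on a71+** (same `q, p`; type α, `(p/q) = +1`), granted Modularity, CLTZ 1.2, `2`-parity and BCST Thm. A at `p = 2` (`hBCST`,
item 20045's constant): on the good-at-`2` global minimal model `G_k ⊗ ℚ` of `49a1^{(d)}`, `d = −qp = 4k+1` (`j = −3375`, `Δ = −7³d⁶` odd), `corank Sel_{2^∞} = 1`
and `rankOneTwoConverse_goodCell_of_thmA` give `r_an = 1`, an isogeny invariant. This is the χ_Z channel's `h2` on a71+ in tree shape.
[cite: BurungaleCastellaSkinnerTian2022, Thm. A (p. 326) and Rem. D (p. 327)] [cite: DokchitserDokchitserAnnals2010, Thm. 1.4] [cite: SilvermanAEC2009, VII.5 Prop. 5.1(a)] -/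
theorem analyticRank_eq_one_oddTwoPrimesTwist_of_thmA_plusPOneAlpha
    (hBCST : BurungaleCastellaSkinnerTian2022.thmA_analyticRank_eq_one_of_selmerCorank_eq_one) (hnf : exists_isNewformOf)
    (h12 : CoatesLiTianZhai2015.thm12_fullBSD_twist) (hpar : ∀ (V : WeierstrassCurve ℚ) [V.IsElliptic], p_parity V 2)
    (hq8 : q % 8 = 7) (hq7 : jacobiSym q 7 = -1) (hp8 : p % 8 = 1) (hp7 : legendreSym p (-7) = 1) (hα : ¬ ∃ x : ZMod p, x ^ 4 = -7)
    (hpq : jacobiSym p q = 1) :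
    (haveI := cm7.isElliptic_quadraticTwist (show (-((q : ℚ) * p)) ≠ 0 from neg_ne_zero.mpr (mul_ne_zero
        (by exact_mod_cast (Fact.out : q.Prime).ne_zero) (by exact_mod_cast (Fact.out : p.Prime).ne_zero)));
      (cm7.quadraticTwist (-((q : ℚ) * p))).analyticRank) = 1 := by
  have hq : q.Prime := Fact.out
  have hp : p.Prime := Fact.out
  obtain ⟨⟨hq2, hp2, hqp, -, h7Q, h7P⟩, -⟩ := oddTwoPrimes_facts_plusPOne hq8 hq7 hp8 hp7 hpq
  have hd0 : (-((q : ℚ) * p)) ≠ 0 :=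
    neg_ne_zero.mpr (mul_ne_zero (by exact_mod_cast hq.ne_zero) (by exact_mod_cast hp.ne_zero))
  haveI := cm7.isElliptic_quadraticTwist hd0
  ------------------------------------------------------------------ `d = −qp = 4k + 1`
  obtain ⟨k, hk⟩ : ∃ k : ℤ, 4 * k + 1 = -((q : ℤ) * p) := by
    have hq' : (q : ℤ) % 8 = 7 := by exact_mod_cast hq8
    have hp' : (p : ℤ) % 8 = 1 := by exact_mod_cast hp8
    have h4 : (4 : ℤ) ∣ -((q : ℤ) * p) - 1 := by
      have : ((q : ℤ) * p) % 4 = 3 := by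
        rw [Int.mul_emod, show (q : ℤ) % 4 = 3 by omega, show (p : ℤ) % 4 = 1 by omega]; norm_num
      omega
    obtain ⟨k, hk⟩ := h4
    exact ⟨k, by linarith⟩
  have hsq : Squarefree (4 * k + 1) := by
    rw [hk]
    have h := (Int.squarefree_natCast.mpr ((Nat.squarefree_mul ((Nat.coprime_primes hq hp).mpr hqp)).mpr
      ⟨hq.squarefree, hp.squarefree⟩))
    exact h.squarefree_of_dvd ⟨-1, by push_cast; ring⟩
  ------------------------------------------------------------------ the good model `G = G_k ⊗ ℚ` and `C₀ • G = X₀(49)^{(−qp)}`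
  have hCG : (⟨1, 0, -(1 / 2 : ℚ), 0⟩ : VariableChange ℚ) •
      (⟨1, -3 * k - 1, 0, -2 * (4 * k + 1) ^ 2, -(4 * k + 1) ^ 3⟩ : WeierstrassCurve ℤ).baseChange ℚ =
        cm7.quadraticTwist (-((q : ℚ) * p)) := by
    rw [completeSquare_smul_goodModel_baseChange, hk]; push_cast; rfl
  haveI hGE : ((⟨1, -3 * k - 1, 0, -2 * (4 * k + 1) ^ 2, -(4 * k + 1) ^ 3⟩ : WeierstrassCurve ℤ).baseChange ℚ).IsElliptic := by
    rw [show (⟨1, -3 * k - 1, 0, -2 * (4 * k + 1) ^ 2, -(4 * k + 1) ^ 3⟩ : WeierstrassCurve ℤ).baseChange ℚ =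
      (⟨1, 0, -(1 / 2 : ℚ), 0⟩ : VariableChange ℚ)⁻¹ • cm7.quadraticTwist (-((q : ℚ) * p)) by rw [← hCG, inv_smul_smul]]
    infer_instance
  haveI := isGloballyMinimal_goodModel hsq
  ------------------------------------------------------------------ `j = −3375`, good reduction at `2`, `corank Sel_{2^∞} = 1`
  have hj' : ∀ (X : WeierstrassCurve ℚ) [X.IsElliptic], X = cm7.quadraticTwist (-((q : ℚ) * p)) → X.j = -3375 := by
    intro X _ hX; subst hX; rw [j_quadraticTwist _ hd0, j_cm7]
  have hj : ((⟨1, -3 * k - 1, 0, -2 * (4 * k + 1) ^ 2, -(4 * k + 1) ^ 3⟩ : WeierstrassCurve ℤ).baseChange ℚ).j = -3375 :=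
    (variableChange_j _ (⟨1, 0, -(1 / 2 : ℚ), 0⟩ : VariableChange ℚ)).symm.trans (hj' _ hCG)
  have hgood : ((⟨1, -3 * k - 1, 0, -2 * (4 * k + 1) ^ 2, -(4 * k + 1) ^ 3⟩ : WeierstrassCurve ℤ).baseChange ℚ).HasGoodReductionAtPrime 2 := by
    haveI : Fact (Nat.Prime 2) := ⟨Nat.prime_two⟩
    refine hasGoodReductionAtPrime_of_not_dvd _ 2 fun h2 ↦ ?_
    have hΔ := cast_minimalDiscriminantInt ((⟨1, -3 * k - 1, 0, -2 * (4 * k + 1) ^ 2, -(4 * k + 1) ^ 3⟩ : WeierstrassCurve ℤ).baseChange ℚ)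
    have hΔ' : ((⟨1, -3 * k - 1, 0, -2 * (4 * k + 1) ^ 2, -(4 * k + 1) ^ 3⟩ : WeierstrassCurve ℤ).baseChange ℚ).Δ =
        (((-(7 ^ 3 * (4 * k + 1) ^ 6) : ℤ)) : ℚ) := by
      rw [← goodModel_Δ k]; simp [WeierstrassCurve.baseChange, WeierstrassCurve.map_Δ]
    rw [hΔ'] at hΔ
    have hmin : minimalDiscriminantInt ((⟨1, -3 * k - 1, 0, -2 * (4 * k + 1) ^ 2, -(4 * k + 1) ^ 3⟩ : WeierstrassCurve ℤ).baseChange ℚ) =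
        -(7 ^ 3 * (4 * k + 1) ^ 6) := by exact_mod_cast hΔ
    rw [hmin, Int.dvd_neg] at h2
    have h2' : (2 : ℤ) ∣ (4 * k + 1) ^ 6 := by
      rcases (Int.prime_two.dvd_or_dvd h2) with h | h
      · exact absurd (Int.prime_two.dvd_of_dvd_pow h) (by norm_num)
      · exact h
    have h2'' := Int.prime_two.dvd_of_dvd_pow h2'
    omega
  have hsel : ((⟨1, -3 * k - 1, 0, -2 * (4 * k + 1) ^ 2, -(4 * k + 1) ^ 3⟩ : WeierstrassCurve ℤ).baseChange ℚ).selmerCorank 2 = 1 :=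
    selmerCorank_two_eq_one_oddTwoPrimesTwist_plusPOneAlpha hnf h12 hpar hq8 hq7 hp8 hp7 hα hpq _ _ (by rw [hCG]; push_cast; rfl)
  ------------------------------------------------------------------ BCST Thm. A on the good cell, and isogeny invariance of `r_an`
  have hG := rankOneTwoConverse_goodCell_of_thmA hBCST _ hj hgood hsel
  rw [← hG]
  exact (analyticRank_eq_of_isIsogenous' (isIsogenous_of_smul_eq hCG)).symm

end OddDescentPlusPOneAlpha

end Summit.BirchSwinnertonDyer.BirchSwinnertonDyer.Theorems.GoldfeldGoodTwists
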